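import Summits.BirchSwinnertonDyer.BirchSwinnertonDyer.Theorems.KimAtThreeD7uTamagawaFreeStructures
import Summits.BirchSwinnertonDyer.BirchSwinnertonDyer.Theorems.InertBadSignedBranchesInertBadAtThreeIstarZeroOddPair
import HarnessLib

/-!
# The TAMAGAWA-FREE places, IV: the route's hypothesis `p ∤ ∏_v c_v` (`W.tamagawaProduct`) —
# `𝓕_u = 𝓕_can` for odd `p ∤ ∏ c_v`, equal Selmer groups, equal modules of Kolyvagin systems;
# and `𝓕_u` is unramified outside `∞ ∪ {p} ∪ {bad}` (every curve)
# (cell `bsd-addord`, seat w2-tamdiv gen 3; route W2 `KimAtThreeKolyvagin`, items 19562 / 19560, «TamDiv∞»)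

HONEST FRAMING: TOOL theorems (no definition, no named fact, no `sorry`); closes nothing by itself;
nothing is booked; BSD is not proved by any of this.  Parts I–III (`KimAtThreeD7uTamagawaFreePlaces`,
`…Structures`, `…Tate`) prove that at a finite `w ∤ p` with `p ∤ c_w` [MR04]'s unramified structure
`𝓕_u(w)` equals the canonical `𝓕_can(w)` on `E[p^{k+1}]` (and `H¹_ur(ℚ_w, T_pE) = H¹(ℚ_w, T_pE)`), and
that for odd `p` with `p ∤ c_ℓ` at every bad `ℓ ≠ p` the two Selmer structures coincide.  This file restates
the global results under the SINGLE hypothesis in the currency of the W2 off-stratum rows («`3 ∤ ∏ c_ℓ`»,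
`KolyvaginLevelOneUnitCaseTamagawa`'s `htam : ¬ 3 ∣ W.tamagawaProduct`): `¬ p ∣ W.tamagawaProduct`, using
`c_w ∣ ∏_v c_v` (tree `InertBadOdd.localTamagawaNumber_dvd_tamagawaProduct`, imported, not restated).

* `not_dvd_localTamagawaNumber_of_not_dvd_tamagawaProduct` — `p ∤ ∏ c_v ⇒ p ∤ c_w` for every finite `w`;
* `blochKatoSelmerStructure_inr_eq_propagatedSelmerStructure_of_not_dvd_tamagawaProduct` — any `p`, any `L`,
  every finite `w ∤ p`: `𝓕_u(w) = 𝓕_can(w)`;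
* **`blochKatoSelmerStructure_relaxed_eq_propagatedSelmerStructure_of_odd_of_not_dvd_tamagawaProduct`** —
  odd `p ∤ ∏ c_v`: `blochKatoSelmerStructure p (tateTorsionDatum W p k) ⊤ = propagatedSelmerStructure W p k`;
* `selmerGroup_blochKatoSelmerStructure_eq_of_odd_of_not_dvd_tamagawaProduct`,
  **`kolyvaginSystems_blochKatoSelmerStructure_eq_of_odd_of_not_dvd_tamagawaProduct`** —
  `KS₁(E[p^k · p], 𝓕_u, 𝒫) = KS₁(E[p^k · p], 𝓕_can, 𝒫)` for every Kolyvagin datum: on the «`p ∤ ∏ c_ℓ`» rows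
  the factorisation `ES(T_pE) → KS(𝓕_u) → KS(𝓕_can)` of [MR04] Remark A.5 has NO Tamagawa defect
  (Büyükboduk 2009, hypothesis H.T).

* (no hypothesis) `blochKatoSelmerStructure_inr_eq_unramifiedSubgroup_of_hasGoodReductionAt` (at a GOOD
  `v ∤ p`: `𝓕_u(v) = H¹_ur(ℚ_v, E[p^k · p])`, `c_v = 1`), **`blochKatoSelmerStructure_isUnramifiedOutside`**
  (`𝓕_u` is `IsUnramifiedOutside S` for every finite `S ⊇ ∞ ∪ {v ∣ p} ∪ {bad v}` — the twin for `𝓕_u` of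
  n1011's `propagatedSelmerStructure_isUnramifiedOutside`, i.e. the binder `hunr` of the Kolyvagin-system
  instances) and `exists_finset_blochKatoSelmerStructure_isUnramifiedOutside`.

References: B. Mazur, K. Rubin, Mem. AMS 799 (2004) Def. 2.1.1, Prop. 6.2.6, App. A Remark A.5;
B. Howard, Compos. Math. 140 (2004) Def. 2.1.10; K. Büyükboduk, JNT 129 (2009) §3; K. Rubin,
*Euler Systems* (2000) Lemma 1.3.5; J. H. Silverman, *AEC* VII.§2, Cor. VII.6.2, Rem. VIII.1.3.
-/

noncomputable section

-- the cell's Theorems namespace `Summit.BirchSwinnertonDyer.BirchSwinnertonDyer.…` repeats the summit name by design (D-0017)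
set_option linter.dupNamespace false

open Field IsDedekindDomain NumberField
open scoped NumberField Classical
open Literature.NumberTheory.GaloisRepresentations Literature.NumberTheory.EllipticCurves
open Literature.NumberTheory.GaloisCohomology
open WeierstrassCurve
open Summit.BirchSwinnertonDyer.Rank1Residual.GaloisImage
open Summit.BirchSwinnertonDyer.BirchSwinnertonDyer.Theorems
open Summit.BirchSwinnertonDyer.BirchSwinnertonDyer.Theorems.KimAtThreeD7uTamagawaFreeStructures

namespace Summit.BirchSwinnertonDyer.BirchSwinnertonDyer.Theorems.KimAtThreeD7uTamagawaFreeProduct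

/-! ### The hypothesis `p ∤ ∏_v c_v` (`W.tamagawaProduct`) -/

section Product

variable (W : WeierstrassCurve ℚ) [W.IsElliptic] (p : ℕ) [hp : Fact p.Prime] (k : ℕ)

omit hp in
/-- `p ∤ ∏_v c_v` gives `p ∤ c_w` at every finite place. [folklore] -/
theorem not_dvd_localTamagawaNumber_of_not_dvd_tamagawaProduct (htam : ¬ p ∣ W.tamagawaProduct)
    (w : HeightOneSpectrum (𝓞 ℚ)) :
    ¬ p ∣ (W.baseChange (w.adicCompletion ℚ)).localTamagawaNumber (w.adicCompletionIntegers ℚ) :=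
  fun h => htam (h.trans (InertBadOdd.localTamagawaNumber_dvd_tamagawaProduct W w))

/-- **`𝓕_u(w) = 𝓕_can(w)` at every finite `w ∤ p` when `p ∤ ∏_v c_v`**, for any choice `L` above `p`.
[cite: Rubin2000, Lemma 1.3.5] [cite: MazurRubin2004, Prop. 6.2.6 (p. 75) and App. A Remark A.5 (p. 81)] -/
theorem blochKatoSelmerStructure_inr_eq_propagatedSelmerStructure_of_not_dvd_tamagawaProduct
    (L : (tateTorsionDatum W p k).LocalConditionsAbove p) (htam : ¬ p ∣ W.tamagawaProduct)
    (w : HeightOneSpectrum (𝓞 ℚ)) (hw : ((p : ℕ) : 𝓞 ℚ) ∉ w.asIdeal) :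
    blochKatoSelmerStructure p (tateTorsionDatum W p k) L (Sum.inr w) =
      propagatedSelmerStructure W p k (Sum.inr w) :=
  blochKatoSelmerStructure_inr_eq_propagatedSelmerStructure_of_not_dvd_localTamagawaNumber W p k w L hw
    (not_dvd_localTamagawaNumber_of_not_dvd_tamagawaProduct W p htam w)

/-- **`𝓕_u = 𝓕_can` as Selmer structures on `E[p^k · p]` for odd `p ∤ ∏_v c_v`** (relaxed condition
above `p`) — the «`p ∤ ∏ c_ℓ`» rows carry NO Tamagawa defect at Kolyvagin-system level.
[cite: MazurRubin2004, Prop. 6.2.6 (p. 75) and App. A Remark A.5 (p. 81)] [cite: Rubin2000, Lemma 1.3.5] -/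
theorem blochKatoSelmerStructure_relaxed_eq_propagatedSelmerStructure_of_odd_of_not_dvd_tamagawaProduct
    (hp2 : p ≠ 2) (htam : ¬ p ∣ W.tamagawaProduct) :
    blochKatoSelmerStructure p (tateTorsionDatum W p k) (fun _ _ => ⊤) = propagatedSelmerStructure W p k :=
  blochKatoSelmerStructure_relaxed_eq_propagatedSelmerStructure_of_odd_of_forall_not_dvd_localTamagawaNumber
    W p k hp2 fun w _ _ => not_dvd_localTamagawaNumber_of_not_dvd_tamagawaProduct W p htam w

/-- **Equal Selmer groups for odd `p ∤ ∏_v c_v`**: `H¹_{𝓕_u}(ℚ, E[p^k · p]) = H¹_{𝓕_can}(ℚ, E[p^k · p])`.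
[cite: MazurRubin2004, Prop. 6.2.6 (p. 75) and App. A Remark A.5 (p. 81)] -/
theorem selmerGroup_blochKatoSelmerStructure_eq_of_odd_of_not_dvd_tamagawaProduct
    (hp2 : p ≠ 2) (htam : ¬ p ∣ W.tamagawaProduct) :
    (blochKatoSelmerStructure p (tateTorsionDatum W p k) (fun _ _ => ⊤)).selmerGroup =
      (propagatedSelmerStructure W p k).selmerGroup :=
  selmerGroup_blochKatoSelmerStructure_eq_of_odd_of_forall_not_dvd_localTamagawaNumber W p k hp2
    fun w _ _ => not_dvd_localTamagawaNumber_of_not_dvd_tamagawaProduct W p htam w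

/-- **`KS₁(E[p^k · p], 𝓕_u, 𝒫) = KS₁(E[p^k · p], 𝓕_can, 𝒫)` for odd `p ∤ ∏_v c_v`** and every Kolyvagin
datum: [MR04] Remark A.5's factorisation `ES(T_pE) → KS(𝓕_u) → KS(𝓕_can)` loses nothing on these rows
(Büyükboduk's hypothesis H.T). [cite: MazurRubin2004, Prop. 6.2.6 (p. 75) and App. A Remark A.5 (p. 81)] -/
theorem kolyvaginSystems_blochKatoSelmerStructure_eq_of_odd_of_not_dvd_tamagawaProduct
    (hp2 : p ≠ 2) (htam : ¬ p ∣ W.tamagawaProduct)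
    (D : KolyvaginDatum (W.torsionGaloisModule ((p : ℤ) ^ k * (p : ℤ)))) :
    D.kolyvaginSystems (blochKatoSelmerStructure p (tateTorsionDatum W p k) (fun _ _ => ⊤)) =
      D.kolyvaginSystems (propagatedSelmerStructure W p k) :=
  kolyvaginSystems_blochKatoSelmerStructure_eq_of_odd_of_forall_not_dvd_localTamagawaNumber W p k hp2
    (fun w _ _ => not_dvd_localTamagawaNumber_of_not_dvd_tamagawaProduct W p htam w) D

end Product

/-! ### `𝓕_u` is unramified outside `∞ ∪ {p} ∪ {bad}` (every curve, every `L`) -/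

section Unramified

variable (W : WeierstrassCurve ℚ) [W.IsElliptic] (p : ℕ) [hp : Fact p.Prime] (k : ℕ)

/-- **At a GOOD place `v ∤ p` the Bloch–Kato / unramified structure of `π_{k+1}` IS the unramified
subgroup of `H¹(ℚ_v, E[p^k · p])`** (no Tamagawa hypothesis: `c_v = 1` at good reduction,
`not_dvd_localTamagawaNumber_of_hasGoodReductionAt`), for every choice `L` above `p`.
[cite: Rubin2011, §3.1 (p. 29)] [cite: SilvermanAEC2009, VII.§2 (remark after Prop. 2.1)] -/
theorem blochKatoSelmerStructure_inr_eq_unramifiedSubgroup_of_hasGoodReductionAt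
    (L : (tateTorsionDatum W p k).LocalConditionsAbove p) {v : HeightOneSpectrum (𝓞 ℚ)}
    (hpv : ((p : ℕ) : 𝓞 ℚ) ∉ v.asIdeal) (hgood : W.HasGoodReductionAt v) :
    blochKatoSelmerStructure p (tateTorsionDatum W p k) L (Sum.inr v) =
      DiscreteGaloisModule.unramifiedSubgroup
        (GaloisRep.toLocal v (W.torsionGaloisModule ((p : ℤ) ^ k * (p : ℤ)))) 1 :=
  blochKatoSelmerStructure_inr_eq_unramifiedSubgroup_of_not_dvd_localTamagawaNumber W p k v L hpv
    (InertiaDivisible.not_dvd_localTamagawaNumber_of_hasGoodReductionAt W p hgood)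

/-- **`𝓕_u = blochKatoSelmerStructure p (tateTorsionDatum W p k) L` is UNRAMIFIED OUTSIDE every finite
`S ⊇ ∞ ∪ {v ∣ p} ∪ {bad v}`** (Howard Def. 2.1.10 / Mazur–Rubin Def. 2.1.1, the tree's
`SelmerStructure.IsUnramifiedOutside`) — for EVERY elliptic curve over `ℚ`, every `p`, `k`, `L`: the twin
for `𝓕_u` of n1011's `propagatedSelmerStructure_isUnramifiedOutside` (the binder `hunr` of the Kolyvagin-
system instances).  [cite: Howard2004HeegnerKolyvagin, Def. 2.1.10 (arXiv:1202.6340 p. 6)]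
[cite: Rubin2011, §3.1 (p. 29)] -/
theorem blochKatoSelmerStructure_isUnramifiedOutside
    (L : (tateTorsionDatum W p k).LocalConditionsAbove p) (S : Finset (Place ℚ))
    (hinf : ∀ w : InfinitePlace ℚ, (Sum.inl w : Place ℚ) ∈ S)
    (hpS : ∀ v : HeightOneSpectrum (𝓞 ℚ), ((p : ℕ) : 𝓞 ℚ) ∈ v.asIdeal → (Sum.inr v : Place ℚ) ∈ S)
    (hbad : ∀ v : HeightOneSpectrum (𝓞 ℚ), ¬ W.HasGoodReductionAt v → (Sum.inr v : Place ℚ) ∈ S) :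
    (blochKatoSelmerStructure p (tateTorsionDatum W p k) L).IsUnramifiedOutside S := by
  refine ⟨hinf, fun v hvS => ?_⟩
  have hpv : ((p : ℕ) : 𝓞 ℚ) ∉ v.asIdeal := fun h => hvS (hpS v h)
  have hgood : W.HasGoodReductionAt v := by
    by_contra h
    exact hvS (hbad v h)
  exact blochKatoSelmerStructure_inr_eq_unramifiedSubgroup_of_hasGoodReductionAt W p k L hpv hgood

/-- **An admissible `S` exists for `𝓕_u`** (with `hS`, `hS'`, `hunr` in the shape of n1011's
`exists_finset_isUnramifiedOutside`): `S = ∞ ∪ {v ∣ p} ∪ {bad v}`.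
[cite: Howard2004HeegnerKolyvagin, Def. 2.1.10 (arXiv:1202.6340 p. 6)] [cite: SilvermanAEC2009, Rem. VIII.1.3] -/
theorem exists_finset_blochKatoSelmerStructure_isUnramifiedOutside
    (L : (tateTorsionDatum W p k).LocalConditionsAbove p) :
    ∃ S : Finset (Place ℚ), (∀ w : InfinitePlace ℚ, (Sum.inl w : Place ℚ) ∈ S) ∧
      (∀ v : HeightOneSpectrum (𝓞 ℚ), (Sum.inr v : Place ℚ) ∉ S →
        ((p : ℕ) : 𝓞 ℚ) ∉ v.asIdeal ∧
          GaloisRep.IsUnramifiedAt v (W.torsionGaloisModule ((p : ℤ) ^ k * (p : ℤ)))) ∧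
      (blochKatoSelmerStructure p (tateTorsionDatum W p k) L).IsUnramifiedOutside S := by
  obtain ⟨S, -, hinf, hpS, hbad⟩ := Summit.BirchSwinnertonDyer.Rank1Residual.X11b.KummerPT.exists_exceptional_finset W p (∅ : Finset (Place ℚ))
  exact ⟨S, hinf, fun v hvS => not_mem_and_isUnramifiedAt_of_not_mem W p k S hpS hbad hvS,
    blochKatoSelmerStructure_isUnramifiedOutside W p k L S hinf hpS hbad⟩

end Unramified

end Summit.BirchSwinnertonDyer.BirchSwinnertonDyer.Theorems.KimAtThreeD7uTamagawaFreeProduct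

end
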